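import Summits.BirchSwinnertonDyer.BirchSwinnertonDyer.Theorems.ManinLocalTwoThreeHeckeRepIndependence
import HarnessLib

/-!
# `T_r` commutes with conjugation by a normalising element on degree-`0` cocycles (σ2 of MEMO-es §25.6, general form)

Summit `BirchSwinnertonDyer`, route `ManinLocalTwoThree` (cell bsd-f2-manin), crux C2 `ManinOddAtFour` (stmt-BirchSwinnertonDyer-22967),
line `kato_shift_two` v6, stub 3 (`C₃`-image residual; MEMO-es §25).  The descent steps of §25 form auxiliary cocycles
`u ∘ Ad(g) − u` for elements `g` normalising `Γ₀(N)` (E-es-37: `g = U⁻(2^{j−1}L′)` at level `2^jL′`; E-es-42: Atkin–Lehner) and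
need them to be generalised Hecke eigenvectors, i.e. `T_r ∘ Ad(g) = Ad(g) ∘ T_r` on `Hom(Γ₀(N), R)`.  This file proves the
general statement **`heckeU_zero_conj`**: if `g ∈ SL₂(ℤ)` satisfies `γ ∈ Γ₀(N) ⟺ gγg⁻¹ ∈ Γ₀(N)` and carries every Hecke
representative into the double coset, `g βᵢ g⁻¹ ∈ Δ₀ᴺ(p)` (tree `Delta0 N p`), then for every degree-`0` cocycle `u`,
`(T_p (u ∘ Ad g))(γ) = (T_p u)(gγg⁻¹)`.  Proof: `g βᵢ g⁻¹ = δᵢ β_{π i}` with `δᵢ ∈ Γ₀(N)` and `π` a permutation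
(`existsUnique_mem_delta0_mul_heckeRep`), and the representative-independence of `heckeU 0`
(`heckeU_zero_apply_eq_sum_of_reps`, `Theorems/ManinLocalTwoThreeHeckeRepIndependence.lean`) applied to the system `g βᵢ g⁻¹`
at the element `gγg⁻¹`, whose permutation data are `g γ′ᵢ g⁻¹`.  No new definitions; nothing about BSD or Manin's conjecture
is proved here.

References: G. Shimura (1971) §8.3 (8.3.2), Prop. 3.36 [cite: Shimura1971, §8.3 (8.3.2)]; cell memo HOME/MEMO-es.md §25.6 σ2,
§25.10; cell INBOX 2026-08-28T04:15:22Z (es: the exact `(level, g)` pairs).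
-/

set_option autoImplicit false
set_option linter.dupNamespace false

open scoped MatrixGroups

open CongruenceSubgroup Matrix.SpecialLinearGroup Literature.NumberTheory.EllipticCurves.ModularForms
  Literature.NumberTheory.EllipticCurves.ModularForms.HidaCohomology

namespace Summit.BirchSwinnertonDyer.BirchSwinnertonDyer.Theorems.ManinLocalTwoThree

section Conj

variable {N p : ℕ} [NeZero p] (hp : p.Prime) {R : Type*} [CommRing R] {g : SL(2, ℤ)}

/-- **`T_p ∘ Ad(g) = Ad(g) ∘ T_p` on `Hom(Γ₀(N), R)`** for `g ∈ SL₂(ℤ)` with `γ ∈ Γ₀(N) ⟺ g γ g⁻¹ ∈ Γ₀(N)` and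
`g βᵢ g⁻¹ ∈ Δ₀ᴺ(p)` for every Hecke representative: for a degree-`0` cocycle `u` and `γ ∈ Γ₀(N)`,
`(T_p (δ ↦ u(g δ g⁻¹)))(γ) = (T_p u)(g γ g⁻¹)`. [cite: Shimura1971, §8.3 (8.3.2)] -/
theorem heckeU_zero_conj (hnorm : ∀ γ : SL(2, ℤ), γ ∈ Gamma0 N ↔ g * γ * g⁻¹ ∈ Gamma0 N)
    (hrep : ∀ i : HeckeIdx N p,
      (g : Matrix (Fin 2) (Fin 2) ℤ) * heckeRep p i.1 * ((g⁻¹ : SL(2, ℤ)) : Matrix (Fin 2) (Fin 2) ℤ) ∈ Delta0 N (p * 1))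
    {u : Gamma0 N → Fin 1 → R} (hu : u ∈ cocycles 0 N R) (γ : Gamma0 N) :
    heckeU 0 N R hp (fun δ ↦ u ⟨g * (δ : SL(2, ℤ)) * g⁻¹, (hnorm δ).mp δ.2⟩) γ =
      heckeU 0 N R hp u ⟨g * (γ : SL(2, ℤ)) * g⁻¹, (hnorm γ).mp γ.2⟩ := by
  classical
  have hp1 : ¬ (p : ℤ) ∣ 1 := not_intCast_dvd_one hp
  have hL : ∀ X : Matrix (Fin 2) (Fin 2) ℤ, ((g⁻¹ : SL(2, ℤ)) : Matrix (Fin 2) (Fin 2) ℤ) * ((g : Matrix (Fin 2) (Fin 2) ℤ) * X) = X :=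
    fun X ↦ by rw [← Matrix.mul_assoc, coe_inv_mul_coe, Matrix.one_mul]
  have hL' : ∀ X : Matrix (Fin 2) (Fin 2) ℤ, (g : Matrix (Fin 2) (Fin 2) ℤ) * (((g⁻¹ : SL(2, ℤ)) : Matrix (Fin 2) (Fin 2) ℤ) * X) = X :=
    fun X ↦ by rw [← Matrix.mul_assoc, coe_mul_coe_inv, Matrix.one_mul]
  -- `g βᵢ g⁻¹ = δᵢ β_{k i}` with `δᵢ ∈ Γ₀(N)`
  have hdec : ∀ i : HeckeIdx N p, ∃ k : HeckeIdx N p, ∃ δ : Gamma0 N,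
      gmat δ * heckeRep p k.1 =
        (g : Matrix (Fin 2) (Fin 2) ℤ) * heckeRep p i.1 * ((g⁻¹ : SL(2, ℤ)) : Matrix (Fin 2) (Fin 2) ℤ) := by
    intro i
    obtain ⟨k, ⟨M', hM', hk⟩, -⟩ := existsUnique_mem_delta0_mul_heckeRep hp hp1 (hrep i)
    obtain ⟨δ, hδ, hδk⟩ := (exists_mem_delta0_one_iff (N := N) (fun M ↦ M * heckeRep p k.1 =
      (g : Matrix (Fin 2) (Fin 2) ℤ) * heckeRep p i.1 * ((g⁻¹ : SL(2, ℤ)) : Matrix (Fin 2) (Fin 2) ℤ))).mp ⟨M', hM', hk⟩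
    exact ⟨k, ⟨δ, hδ⟩, hδk⟩
  choose k δ hδ using hdec
  -- `k` is injective: `βᵢ ∈ Γ₀(N) β_{i'}` forces `i = i'`
  have hk_inj : Function.Injective k := by
    intro i i' hii'
    have h1 := hδ i
    have h2 := hδ i'
    rw [hii'] at h1
    -- `βᵢ = (g⁻¹ δᵢ δᵢ'⁻¹ g) β_{i'}`
    let ε : SL(2, ℤ) := g⁻¹ * (((δ i : Gamma0 N) : SL(2, ℤ)) * ((δ i' : Gamma0 N) : SL(2, ℤ))⁻¹) * g
    have hX : ((δ i : Gamma0 N) : SL(2, ℤ)) * ((δ i' : Gamma0 N) : SL(2, ℤ))⁻¹ ∈ Gamma0 N :=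
      Subgroup.mul_mem _ (δ i).2 (Subgroup.inv_mem _ (δ i').2)
    have hgε : g * ε * g⁻¹ = ((δ i : Gamma0 N) : SL(2, ℤ)) * ((δ i' : Gamma0 N) : SL(2, ℤ))⁻¹ := by
      simp only [ε]; group
    have hεmem : ε ∈ Gamma0 N := (hnorm ε).mpr (by rw [hgε]; exact hX)
    have hεβ : (ε : Matrix (Fin 2) (Fin 2) ℤ) * heckeRep p i'.1 = heckeRep p i.1 := by
      -- from `h1 : δᵢ β_{k i'} = g βᵢ g⁻¹`, `h2 : δᵢ' β_{k i'} = g βᵢ' g⁻¹`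
      have e1 : heckeRep p (k i').1 = ((((δ i' : Gamma0 N) : SL(2, ℤ))⁻¹ : SL(2, ℤ)) : Matrix (Fin 2) (Fin 2) ℤ) *
          ((g : Matrix (Fin 2) (Fin 2) ℤ) * heckeRep p i'.1 * ((g⁻¹ : SL(2, ℤ)) : Matrix (Fin 2) (Fin 2) ℤ)) := by
        rw [← h2, ← Matrix.mul_assoc, gmat, coe_inv_mul_coe, Matrix.one_mul]
      have e2 : (g : Matrix (Fin 2) (Fin 2) ℤ) * heckeRep p i.1 * ((g⁻¹ : SL(2, ℤ)) : Matrix (Fin 2) (Fin 2) ℤ) =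
          gmat (δ i) * ((((δ i' : Gamma0 N) : SL(2, ℤ))⁻¹ : SL(2, ℤ)) : Matrix (Fin 2) (Fin 2) ℤ) *
          ((g : Matrix (Fin 2) (Fin 2) ℤ) * heckeRep p i'.1 * ((g⁻¹ : SL(2, ℤ)) : Matrix (Fin 2) (Fin 2) ℤ)) := by
        rw [← h1, e1]; simp only [Matrix.mul_assoc]
      simp only [ε, Matrix.SpecialLinearGroup.coe_mul]
      have hδinv : ∀ X : Matrix (Fin 2) (Fin 2) ℤ, ((((δ i : Gamma0 N) : SL(2, ℤ))⁻¹ : SL(2, ℤ)) : Matrix (Fin 2) (Fin 2) ℤ) *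
          ((((δ i : Gamma0 N) : SL(2, ℤ)) : Matrix (Fin 2) (Fin 2) ℤ) * X) = X :=
        fun X ↦ by rw [← Matrix.mul_assoc, coe_inv_mul_coe, Matrix.one_mul]
      -- `g⁻¹ δᵢ δᵢ'⁻¹ g βᵢ' = g⁻¹ (δᵢ δᵢ'⁻¹ (g βᵢ' g⁻¹)) g = g⁻¹ (g βᵢ g⁻¹) g = βᵢ`
      have e3 : ((((δ i : Gamma0 N) : SL(2, ℤ)) : Matrix (Fin 2) (Fin 2) ℤ)) *
          (((((δ i' : Gamma0 N) : SL(2, ℤ))⁻¹ : SL(2, ℤ)) : Matrix (Fin 2) (Fin 2) ℤ) *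
          ((g : Matrix (Fin 2) (Fin 2) ℤ) * (heckeRep p i'.1 * ((g⁻¹ : SL(2, ℤ)) : Matrix (Fin 2) (Fin 2) ℤ)))) =
          (g : Matrix (Fin 2) (Fin 2) ℤ) * (heckeRep p i.1 * ((g⁻¹ : SL(2, ℤ)) : Matrix (Fin 2) (Fin 2) ℤ)) := by
        have := e2
        simp only [Matrix.mul_assoc, gmat] at this
        exact this.symm
      simp only [Matrix.mul_assoc]
      have e4 := congrArg (· * (g : Matrix (Fin 2) (Fin 2) ℤ)) e3
      simp only [Matrix.mul_assoc, coe_inv_mul_coe, Matrix.mul_one] at e4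
      rw [e4, hL]
    -- uniqueness of the coset of `βᵢ`
    have hM : heckeRep p i.1 ∈ Delta0 N (p * 1) := by simpa using heckeRep_mem_delta0 hp i
    have hu' := existsUnique_mem_delta0_mul_heckeRep hp hp1 hM
    exact hu'.unique ⟨1, one_mem_delta0_one, by rw [Matrix.one_mul]⟩
      ⟨_, coe_mem_delta0_one ⟨ε, hεmem⟩, hεβ⟩
  let π : HeckeIdx N p ≃ HeckeIdx N p := Equiv.ofBijective k (Finite.injective_iff_bijective.mp hk_inj)
  -- apply representative-independence at the element `g γ g⁻¹` with the system `g βᵢ g⁻¹ = δᵢ β_{π i}`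
  set γg : Gamma0 N := ⟨g * (γ : SL(2, ℤ)) * g⁻¹, (hnorm γ).mp γ.2⟩ with hγg
  let γ'' : HeckeIdx N p → Gamma0 N := fun i ↦
    ⟨g * ((heckePermElt hp γ i : Gamma0 N) : SL(2, ℤ)) * g⁻¹, (hnorm _).mp (heckePermElt hp γ i).2⟩
  have hdata : ∀ i, gmat (δ i) * heckeRep p (π i).1 * gmat γg =
      gmat (γ'' i) * (gmat (δ (heckePerm hp γ i)) * heckeRep p (π (heckePerm hp γ i)).1) := by
    intro i
    show gmat (δ i) * heckeRep p (k i).1 * gmat γg = gmat (γ'' i) * (gmat (δ (heckePerm hp γ i)) * heckeRep p (k _).1)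
    rw [hδ i, hδ (heckePerm hp γ i)]
    have hspec := gmat_heckePermElt_mul hp γ i
    show (g : Matrix (Fin 2) (Fin 2) ℤ) * heckeRep p i.1 * ((g⁻¹ : SL(2, ℤ)) : Matrix (Fin 2) (Fin 2) ℤ) *
        ((g * (γ : SL(2, ℤ)) * g⁻¹ : SL(2, ℤ)) : Matrix (Fin 2) (Fin 2) ℤ) =
      ((g * ((heckePermElt hp γ i : Gamma0 N) : SL(2, ℤ)) * g⁻¹ : SL(2, ℤ)) : Matrix (Fin 2) (Fin 2) ℤ) *
        ((g : Matrix (Fin 2) (Fin 2) ℤ) * heckeRep p (heckePerm hp γ i).1 * ((g⁻¹ : SL(2, ℤ)) : Matrix (Fin 2) (Fin 2) ℤ))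
    simp only [Matrix.SpecialLinearGroup.coe_mul, Matrix.mul_assoc, hL]
    rw [← Matrix.mul_assoc (heckeRep p i.1), ← gmat, ← hspec]
    simp only [Matrix.mul_assoc, gmat]
  rw [heckeU_zero_apply_eq_sum_of_reps hp hu γg π δ (heckePerm hp γ) γ'' hdata, heckeU_apply]
  simp only [act_zero_eq_id, LinearMap.id_apply]
  rfl

end Conj

end Summit.BirchSwinnertonDyer.BirchSwinnertonDyer.Theorems.ManinLocalTwoThree
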